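import Literature.Probability.RandomPlanarGeometry.YangBaxterSAWBoundaryWinding
import Literature.Probability.RandomPlanarGeometry.HexSAWBridgeDecay
import HarnessLib

/-!
# Glazman–Manolescu, Proposition 1.1 (limit part): `B_T(π/3) → 0` — the discharge

Topic `Literature/Probability/RandomPlanarGeometry`; this file DISCHARGES the named fact
`Literature.Probability.RandomPlanarGeometry.SAW.YangBaxter.GlazmanManolescu2019_prop11_limit` of
`YangBaxterSAWTwoPoint.lean` (`GlazmanManolescu2019_prop11_limit_holds`): "the partition function of
self-avoiding bridges on the hexagonal lattice vanishes at infinity: `B_T(π/3) → 0` as `T → ∞`"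
(A. Glazman, I. Manolescu, *Self-avoiding walk on `ℤ²` with Yang–Baxter weights: universality of
critical fugacity and 2-point function*, Ann. Inst. Henri Poincaré Probab. Stat. 56 (2020),
arXiv:1708.00395, **Proposition 1.1**; first proved in [BBDDG]). With it, Theorems 1 and 2 of the
paper hold as soon as Proposition 4.2 does (`GlazmanManolescu2019_thm1_of_prop11_prop42`,
`…thm2_of_prop11_prop42` in `YangBaxterSAWExcursion.lean`).

The decay itself is proved on the hexagonal lattice, in the coordinate model `HV` of the
Duminil-Copin–Smirnov development, in `HexSAWTriangle.lean` (Lemma 4.1) and `HexSAWBridgeDecay.lean`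
(the rotation argument of §4.1): `HV.stripB_eventually_le` says that DCS's bridge partition
functions `B_{T,L'}(x_c)` are `≤ ε` for all large `T`, uniformly in `L'`. The present file supplies
the link between the two encodings, i.e. the sentence "if `Θ` is the constant sequence equal to
`π/3`, then each rhombus of `H(Θ)` may be partitioned into triangles, and `H(Θ)` becomes a
triangular lattice. The self-avoiding walk model described above becomes that on the hexagonal
lattice dual to the triangular one, with weight `(1/√(2+√2))^{|γ|}`" (§1, p. 3, Fig. 2), in the
form of a weight-preserving injection of the Yang–Baxter bridges of `Strip_T` at `Θ ≡ π/3` into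
DCS's bridges of the strip `S_T` of `T` rows of hexagons:

* `Side.tri`, `Face.hv` — the two equilateral triangles of the rhombus `(k, j)`: the one containing
  its sides `W, N` is the honeycomb vertex `(-j, k, false)`, the one containing `S, E` is
  `(-j, k, true)` ("the rhombus splits into two equilateral triangles along the diagonal joining
  the `(π−θ)`-corners"; the dictionary `face (k, j) ↦ cell (-j, k)` is forced by the adjacencies of
  `hvGraph`, up to the mirror symmetry of `ℍ`); `hv_adj_of_side_eq`: crossing a rhombus side is a
  honeycomb edge, and so is the short diagonal (`hv_adj_hv`);
* the local weights at `π/3`: `weightU2/V/W1_pi_div_three` (`u₂ = v = w₁ = x_c²`, with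
  `u₁ = x_c`, `w₂ = 0` from `YangBaxterSAW.lean`), whence `localWeight_pi_div_three`: a rhombus
  weighs `x_c^{number of triangles crossed}` or `0`;
* `YBWalk.arcHV`, `YBWalk.hvUpTo`, `YBWalk.hvInner` — the list of triangles crossed by a walk (one
  per `u₁`-arc, two per `u₂`- or `v`-arc), `hvBridge γ` — the corresponding DCS walk
  `w, O, …, u` of a bridge `γ : 0 → vert T j`; `isMidWalk_hvBridge` (it is a self-avoiding walk of
  `S_{T,L'}` ending on `β`, provided `w_{π/3}(γ) ≠ 0` — a rhombus crossed by two `u₂`-arcs, of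
  weight `w₂ = 0`, is the only way to visit a triangle twice), `weight_hex_eq` (`w_{π/3}(γ) =
  x_c^{ℓ}` or `0`, by regrouping the triangles rhombus by rhombus, `sum_faces_eq`),
  `pairEdges_hvBridge` (the crossed mid-edges are read off the triangle list, so the encoding is
  injective);
* `sum_weight_le_stripB` (the total `π/3`-weight of any finite set of Yang–Baxter bridges of
  `Strip_T` is at most `B_{T,L'}(x_c)` for `L'` large), `bridgePartitionFunction_hex_le`
  (`B_T(π/3) ≤ ε` for `T` large) and the discharge **`GlazmanManolescu2019_prop11_limit_holds`**.

Design notes. Weights vanish exactly on the walks through a rhombus carrying two `u₂`-arcs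
(`w₂(π/3) = 0`), which are also exactly the walks whose triangle list repeats a vertex; they are
simply dropped before injecting (`sum_weight_le_stripB`), so no bijection is needed — only the
inequality `B_T(π/3) ≤ sup_{L'} B_{T,L'}(x_c)` is used. The index calculus of arcs (`fc`, `sIn`,
`sOut`, `not_straight_of_two_arcs`) comes from `YangBaxterSAWBoundaryWinding.lean`.
-/

noncomputable section

open Real Filter Topology
open scoped ENNReal

namespace Literature.Probability.RandomPlanarGeometry.SAW.YangBaxter

open MidEdge

/-! ### The local weights at `θ = π/3` -/

/-- The common denominator at `π/3`: `sin(11π/8) sin(π/2) = -cos(π/8)`.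
[cite: GlazmanManolescu2019, eq. (1)] -/
theorem weightDen_pi_div_three : weightDen (π / 3) = -Real.cos (π / 8) := by
  have h2 : 5 * π / 4 + 3 * (π / 3) / 8 = (π / 2 - π / 8) + π := by ring
  have h3 : 5 * π / 8 - 3 * (π / 3) / 8 = π / 2 := by ring
  rw [weightDen, h2, h3, sin_add_pi, sin_pi_div_two_sub, sin_pi_div_two, mul_one]

/-- `(√2/2) tan(π/8) = 1/(2+√2)` (from `4 sin(π/8) cos(π/8) = √2` and `cos²(π/8) = (2+√2)/4`).
[folklore] -/
theorem sqrt_two_div_two_mul_sin_div_cos_pi_div_eight :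
    Real.sqrt 2 / 2 * Real.sin (π / 8) / Real.cos (π / 8) = (2 + Real.sqrt 2)⁻¹ := by
  have hc : 0 < Real.cos (π / 8) := by rw [cos_pi_div_eight]; positivity
  have h4 := four_mul_sin_mul_cos_pi_div_eight
  have hcos : Real.cos (π / 8) ^ 2 = (2 + Real.sqrt 2) / 4 := by
    rw [cos_pi_div_eight, div_pow, Real.sq_sqrt (by positivity)]; norm_num
  have h22 : Real.sqrt 2 * Real.sqrt 2 = 2 := Real.mul_self_sqrt (by norm_num)
  have hs2 : (0 : ℝ) < 2 + Real.sqrt 2 := by positivity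
  have e1 : Real.sqrt 2 * Real.sin (π / 8) * Real.cos (π / 8) = 1 / 2 := by
    linear_combination (Real.sqrt 2 / 4) * h4 + (1 / 4 : ℝ) * h22
  have key : Real.sqrt 2 / 2 * Real.sin (π / 8) * (2 + Real.sqrt 2) = Real.cos (π / 8) := by
    have h : Real.sqrt 2 / 2 * Real.sin (π / 8) * (2 + Real.sqrt 2) * Real.cos (π / 8) =
        Real.cos (π / 8) * Real.cos (π / 8) := by
      linear_combination (2 + Real.sqrt 2) / 2 * e1 - hcos
    exact mul_right_cancel₀ hc.ne' h
  symm
  rw [eq_div_iff hc.ne', ← key]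
  field_simp

/-- `x_c² = 1/(2+√2)`. [cite: DuminilCopinSmirnov2012, §1 (x_c = 1/√(2+√2))] -/
theorem hexCriticalFugacity_sq : hexCriticalFugacity ^ 2 = (2 + Real.sqrt 2)⁻¹ := by
  rw [hexCriticalFugacity, inv_pow, Real.sq_sqrt (by positivity)]

/-- At `θ = π/3`, `u₂ = x_c²` ("`v = w₁ = u₂ = u₁²`"). [cite: GlazmanManolescu2019, §1 (Fig. 2)] -/
theorem weightU2_pi_div_three : weightU2 (π / 3) = hexCriticalFugacity ^ 2 := by
  rw [weightU2, weightDen_pi_div_three, show 3 * (π / 3) / 8 = π / 8 by ring,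
    show (5 * π / 4 : ℝ) = π / 4 + π by ring, sin_add_pi, sin_pi_div_four, neg_mul, neg_div_neg_eq,
    hexCriticalFugacity_sq, sqrt_two_div_two_mul_sin_div_cos_pi_div_eight]

/-- At `θ = π/3`, `v = x_c²`. [cite: GlazmanManolescu2019, §1 (Fig. 2)] -/
theorem weightV_pi_div_three : weightV (π / 3) = hexCriticalFugacity ^ 2 := by
  rw [weightV, weightDen_pi_div_three, show 5 * π / 8 + 3 * (π / 3) / 8 = π / 4 + π / 2 by ring,
    show 3 * (π / 3) / 8 = π / 8 by ring, sin_add_pi_div_two, cos_pi_div_four, Real.sin_neg, mul_neg,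
    neg_div_neg_eq, hexCriticalFugacity_sq, sqrt_two_div_two_mul_sin_div_cos_pi_div_eight]

/-- At `θ = π/3`, `w₁ = x_c²`. [cite: GlazmanManolescu2019, §1 (Fig. 2)] -/
theorem weightW1_pi_div_three : weightW1 (π / 3) = hexCriticalFugacity ^ 2 := by
  rw [weightW1, weightDen_pi_div_three, show 5 * π / 8 + 3 * (π / 3) / 8 = π / 4 + π / 2 by ring,
    show 5 * π / 4 - 3 * (π / 3) / 8 = π / 8 + π by ring, sin_add_pi_div_two, cos_pi_div_four,
    sin_add_pi, mul_neg, neg_div_neg_eq, hexCriticalFugacity_sq,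
    sqrt_two_div_two_mul_sin_div_cos_pi_div_eight]

/-- **The number of triangles crossed by an arc**: one for an arc cutting off a `θ`-corner (`u₁`),
two for the other arcs (`u₂`, `v`), which cross the short diagonal.
[cite: GlazmanManolescu2019, §1 ("whose intersection with any walk is either void or one arc")] -/
def ArcKind.cost : ArcKind → ℕ
  | .corner => 1
  | .coCorner => 2
  | .straight => 2
  | .degen => 0

/-- **A rhombus of angle `π/3` weighs `x_c` per triangle crossed**, or `0`: `1, u₁ = x_c`,
`u₂ = v = w₁ = x_c²`, `w₂ = 0` (and `0` for the configurations that never occur).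
[cite: GlazmanManolescu2019, §1 ("each contributing 1/√(2−√2) [sic] if traversed by an arc")] -/
theorem localWeight_pi_div_three (l : List ArcKind) :
    localWeight (π / 3) l = hexCriticalFugacity ^ (l.map ArcKind.cost).sum ∨ localWeight (π / 3) l = 0 := by
  rcases l with _ | ⟨κ₁, _ | ⟨κ₂, _ | ⟨κ₃, l⟩⟩⟩
  · left; simp [localWeight]
  · cases κ₁
    · left; simp [localWeight, ArcKind.cost, weightU1_pi_div_three]
    · left; simp [localWeight, ArcKind.cost, weightU2_pi_div_three]
    · left; simp [localWeight, ArcKind.cost, weightV_pi_div_three]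
    · right; rfl
  · cases κ₁ <;> cases κ₂
    case corner.corner => left; simp [localWeight, ArcKind.cost, weightW1_pi_div_three]
    case coCorner.coCorner => right; simp [localWeight, weightW2_pi_div_three]
    all_goals right; rfl
  · right; cases κ₁ <;> cases κ₂ <;> rfl

/-- Two `u₂`-arcs in a rhombus of angle `π/3` weigh `w₂ = 0` (and three or more kinds weigh `0`).
[cite: GlazmanManolescu2019, §1 ("if θ = π/3, then w₂ = 0")] -/
theorem localWeight_pi_div_three_eq_zero {l : List ArcKind} (h : 2 ≤ l.count .coCorner) :
    localWeight (π / 3) l = 0 := by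
  rcases l with _ | ⟨κ₁, _ | ⟨κ₂, _ | ⟨κ₃, l⟩⟩⟩
  · simp at h
  · exact absurd (le_trans h List.count_le_length) (by simp)
  · have h1 : κ₁ = .coCorner ∧ κ₂ = .coCorner := by
      revert h; cases κ₁ <;> cases κ₂ <;> simp
    obtain ⟨rfl, rfl⟩ := h1
    simp [localWeight, weightW2_pi_div_three]
  · cases κ₁ <;> cases κ₂ <;> rfl

/-! ### The two triangles of a rhombus as honeycomb vertices -/

/-- Which triangle of the rhombus a side belongs to: `W, N` lie on the triangle at the `θ`-corner
`W ∩ N` (`false`), `S, E` on the one at the `θ`-corner `S ∩ E` (`true`) — the rhombus being split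
"along the diagonal joining the `(π−θ)`-corners". [cite: GlazmanManolescu2019, §1 (Fig. 2)] -/
def Side.tri : Side → Bool
  | .W => false
  | .N => false
  | .S => true
  | .E => true

/-- **The dictionary rhombi ↔ honeycomb**: the triangle of the rhombus `f = (k, j)` containing its
side `s` is the honeycomb vertex `(-j, k, s.tri)` of the coordinate model `HV` (column `k` of
rhombi = row `x₁ = k` of cells, levels `2k`, `2k+1` of `S_T`). [cite: GlazmanManolescu2019, §1 (Fig. 2)] -/
def Face.hv (f : Face) (s : Side) : HV := (-f.2, f.1, s.tri)

/-- Two triangles coincide iff they are the same triangle of the same rhombus. [folklore] -/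
theorem Face.hv_eq_hv_iff {f g : Face} {s t : Side} : f.hv s = g.hv t ↔ f = g ∧ s.tri = t.tri := by
  obtain ⟨k, j⟩ := f; obtain ⟨k', j'⟩ := g
  simp only [Face.hv, Prod.mk.injEq, neg_inj]
  constructor
  · rintro ⟨h1, h2, h3⟩; exact ⟨⟨h2, h1⟩, h3⟩
  · rintro ⟨⟨h2, h1⟩, h3⟩; exact ⟨h1, h2, h3⟩

/-- An arc between two distinct sides crosses one triangle iff it cuts off a `θ`-corner.
[cite: GlazmanManolescu2019, §1 (Fig. 2)] -/
theorem arcKind_eq_corner_iff {s t : Side} (hst : s ≠ t) : arcKind s t = .corner ↔ s.tri = t.tri := by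
  cases s <;> cases t <;> simp [arcKind, Side.tri] at hst ⊢

/-- An arc between two distinct sides is straight iff it joins opposite sides. [folklore] -/
theorem arcKind_eq_straight_iff {s t : Side} (hst : s ≠ t) : arcKind s t = .straight ↔ t = s.opp := by
  cases s <;> cases t <;> simp [arcKind, Side.opp] at hst ⊢

/-- An arc between distinct, non-opposite sides of different triangles cuts off a `(π−θ)`-corner.
[folklore] -/
theorem arcKind_eq_coCorner {s t : Side} (hst : s ≠ t) (h1 : s.tri ≠ t.tri) (h2 : t ≠ s.opp) :
    arcKind s t = .coCorner := by
  cases s <;> cases t <;> simp [arcKind, Side.opp, Side.tri] at hst h1 h2 ⊢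

/-- The cost of an arc is `1` or `2` according to its triangles. [cite: GlazmanManolescu2019, §1] -/
theorem cost_arcKind {s t : Side} (hst : s ≠ t) :
    (arcKind s t).cost = if s.tri = t.tri then 1 else 2 := by
  cases s <;> cases t <;> simp [arcKind, Side.tri, ArcKind.cost] at hst ⊢

/-- **The short diagonal is a honeycomb edge**: the two triangles of a rhombus are adjacent.
[cite: GlazmanManolescu2019, §1 (Fig. 2)] -/
theorem hv_adj_hv {f : Face} {s t : Side} (h : s.tri ≠ t.tri) : hvGraph.Adj (f.hv s) (f.hv t) := by
  obtain ⟨k, j⟩ := f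
  cases s <;> cases t <;> simp [Side.tri] at h <;> simp [Face.hv, Side.tri, hvGraph_adj, HV.AdjRel]

/-- Two different rhombi with a common side: the four possible configurations. [folklore] -/
theorem side_eq_side_cases {f g : Face} {s t : Side} (h : f.side s = g.side t) (hfg : f ≠ g) :
    (s = .W ∧ t = .E ∧ f = (g.1 + 1, g.2)) ∨ (s = .E ∧ t = .W ∧ g = (f.1 + 1, f.2)) ∨
      (s = .N ∧ t = .S ∧ g = (f.1, f.2 + 1)) ∨ (s = .S ∧ t = .N ∧ f = (g.1, g.2 + 1)) := by
  obtain ⟨k, j⟩ := f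
  obtain ⟨k', j'⟩ := g
  cases s <;> cases t <;>
    simp only [Face.side, MidEdge.vert.injEq, MidEdge.slant.injEq, reduceCtorEq, Prod.mk.injEq,
      ne_eq, not_and] at h hfg ⊢ <;> simp <;> omega

/-- **Crossing a side is a honeycomb edge**: the two triangles bordering a common side of two
different rhombi are adjacent. [cite: GlazmanManolescu2019, §1 (Fig. 2)] -/
theorem hv_adj_of_side_eq {f g : Face} {s t : Side} (h : f.side s = g.side t) (hfg : f ≠ g) :
    hvGraph.Adj (f.hv s) (g.hv t) := by
  rcases side_eq_side_cases h hfg with ⟨rfl, rfl, rfl⟩ | ⟨rfl, rfl, rfl⟩ | ⟨rfl, rfl, rfl⟩ | ⟨rfl, rfl, rfl⟩ <;>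
    simp [Face.hv, Side.tri, hvGraph_adj, HV.AdjRel]
  all_goals omega

/-- The rhombus side crossed between two triangles of different cells, if any (`vert k j` between
`(-j, k-1, true)` and `(-j, k, false)`, `slant k j` between `(-j+1, k, false)` and `(-j, k, true)`).
[cite: GlazmanManolescu2019, §1 (Fig. 2)] -/
def edgeOf (v w : HV) : Option MidEdge :=
  if v.2.2 = true ∧ w.2.2 = false ∧ w.1 = v.1 ∧ w.2.1 = v.2.1 + 1 then some (.vert w.2.1 (-v.1))
  else if v.2.2 = false ∧ w.2.2 = true ∧ w.1 = v.1 ∧ v.2.1 = w.2.1 + 1 then some (.vert v.2.1 (-v.1))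
  else if v.2.2 = false ∧ w.2.2 = true ∧ v.1 = w.1 + 1 ∧ w.2.1 = v.2.1 then some (.slant v.2.1 (-w.1))
  else if v.2.2 = true ∧ w.2.2 = false ∧ w.1 = v.1 + 1 ∧ w.2.1 = v.2.1 then some (.slant v.2.1 (-v.1))
  else none

/-- Inside a rhombus no side is crossed. [folklore] -/
theorem edgeOf_hv_hv (f : Face) (s t : Side) : edgeOf (f.hv s) (f.hv t) = none := by
  obtain ⟨k, j⟩ := f
  cases s <;> cases t <;> simp [edgeOf, Face.hv, Side.tri]

/-- The side crossed between the triangles of two different rhombi bordering it.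
[cite: GlazmanManolescu2019, §1 (Fig. 2)] -/
theorem edgeOf_of_side_eq {f g : Face} {s t : Side} (h : f.side s = g.side t) (hfg : f ≠ g) :
    edgeOf (f.hv s) (g.hv t) = some (f.side s) := by
  rcases side_eq_side_cases h hfg with ⟨rfl, rfl, rfl⟩ | ⟨rfl, rfl, rfl⟩ | ⟨rfl, rfl, rfl⟩ | ⟨rfl, rfl, rfl⟩ <;>
    simp [edgeOf, Face.hv, Side.tri, Face.side]

/-- Four pairwise distinct sides cannot all lie on one triangle, nor can two corner arcs with
disjoint ends lie on the same triangle. [folklore] -/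
theorem Side.tri_four {s₁ s₂ s₃ s₄ : Side} (h12 : s₁ ≠ s₂) (h34 : s₃ ≠ s₄) (h13 : s₃ ≠ s₁)
    (h14 : s₃ ≠ s₂) (h23 : s₄ ≠ s₁) (h24 : s₄ ≠ s₂) (t12 : s₁.tri = s₂.tri) (t34 : s₃.tri = s₄.tri) :
    s₁.tri ≠ s₃.tri := by
  revert h12 h34 h13 h14 h23 h24 t12 t34
  cases s₁ <;> cases s₂ <;> cases s₃ <;> cases s₄ <;> decide

/-- If an arc of a rhombus does not stay in one triangle and is not straight, and a second arc with
disjoint ends is not straight either, then both cut off `(π−θ)`-corners. [folklore] -/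
theorem Side.coCorner_pair {s₁ s₂ s₃ s₄ : Side} (h12 : s₁ ≠ s₂) (h34 : s₃ ≠ s₄) (h13 : s₃ ≠ s₁)
    (h14 : s₃ ≠ s₂) (h23 : s₄ ≠ s₁) (h24 : s₄ ≠ s₂) (t12 : s₁.tri ≠ s₂.tri) (o12 : s₂ ≠ s₁.opp)
    (o34 : s₄ ≠ s₃.opp) : arcKind s₁ s₂ = .coCorner ∧ arcKind s₃ s₄ = .coCorner := by
  revert h12 h34 h13 h14 h23 h24 t12 o12 o34
  cases s₁ <;> cases s₂ <;> cases s₃ <;> cases s₄ <;> decide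

/-! ### The triangle list of a walk -/

namespace YBWalk

variable {D : Set Face} {a z : MidEdge} (γ : YBWalk D a z)

/-- The number of triangles crossed by the `i`-th arc. [cite: GlazmanManolescu2019, §1] -/
def cst (i : ℕ) : ℕ := if (γ.sIn i).tri = (γ.sOut i).tri then 1 else 2

/-- **The triangles crossed by the `i`-th arc**, in order: one (`u₁`-arc) or two.
[cite: GlazmanManolescu2019, §1 (Fig. 2)] -/
def arcHV (i : ℕ) : List HV :=
  if (γ.sIn i).tri = (γ.sOut i).tri then [(γ.fc i).hv (γ.sIn i)]
  else [(γ.fc i).hv (γ.sIn i), (γ.fc i).hv (γ.sOut i)]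

/-- The triangles crossed by the first `i` arcs. [cite: GlazmanManolescu2019, §1] -/
def hvUpTo : ℕ → List HV
  | 0 => []
  | i + 1 => hvUpTo i ++ γ.arcHV i

/-- **The triangles crossed by the walk** (the honeycomb vertices it visits), in order.
[cite: GlazmanManolescu2019, §1 ("becomes that on the hexagonal lattice")] -/
def hvInner : List HV := γ.hvUpTo γ.arcs.length

variable {γ}

/-- An arc crosses at least one triangle. [folklore] -/
theorem arcHV_ne_nil (i : ℕ) : γ.arcHV i ≠ [] := by
  unfold arcHV; split_ifs <;> simp

/-- The first triangle of an arc is the one of its entry side. [folklore] -/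
theorem head?_arcHV (i : ℕ) : (γ.arcHV i).head? = some ((γ.fc i).hv (γ.sIn i)) := by
  unfold arcHV; split_ifs <;> rfl

/-- The last triangle of an arc is the one of its exit side. [folklore] -/
theorem getLast_arcHV (i : ℕ) : (γ.arcHV i).getLast (arcHV_ne_nil i) = (γ.fc i).hv (γ.sOut i) := by
  unfold arcHV
  split_ifs with h
  · simp only [List.getLast_singleton]
    exact Face.hv_eq_hv_iff.2 ⟨rfl, h⟩
  · simp

/-- The last triangle of an arc, through `getLast?`. [folklore] -/
theorem getLast?_arcHV (i : ℕ) : (γ.arcHV i).getLast? = some ((γ.fc i).hv (γ.sOut i)) := by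
  rw [List.getLast?_eq_some_getLast (arcHV_ne_nil i), getLast_arcHV]

/-- The length of `arcHV i` is the cost of the arc. [folklore] -/
theorem length_arcHV (i : ℕ) : (γ.arcHV i).length = γ.cst i := by
  unfold arcHV cst; split_ifs <;> rfl

/-- The triangles of an arc lie in its rhombus. [folklore] -/
theorem mem_arcHV_iff {i : ℕ} {x : HV} :
    x ∈ γ.arcHV i ↔ x = (γ.fc i).hv (γ.sIn i) ∨ x = (γ.fc i).hv (γ.sOut i) := by
  unfold arcHV
  split_ifs with h
  · simp only [List.mem_singleton, Face.hv_eq_hv_iff.2 ⟨rfl, h⟩, or_self]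
  · simp

/-- An arc is a honeycomb path (the short diagonal is an edge). [folklore] -/
theorem isChain_arcHV (i : ℕ) : (γ.arcHV i).IsChain hvGraph.Adj := by
  unfold arcHV
  split_ifs with h
  · simp
  · simp only [List.isChain_cons_cons, List.IsChain.singleton, and_true]
    exact hv_adj_hv h

/-- The triangles of one arc are distinct. [folklore] -/
theorem nodup_arcHV (i : ℕ) : (γ.arcHV i).Nodup := by
  unfold arcHV
  split_ifs with h
  · simp
  · simp only [List.nodup_cons, List.mem_singleton, Face.hv_eq_hv_iff, true_and, List.not_mem_nil,
      not_false_eq_true, List.nodup_nil, and_true]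
    exact h

/-- Inside an arc no side is crossed. [folklore] -/
theorem edgeOf_arcHV (i : ℕ) :
    ∀ p ∈ (γ.arcHV i).zip (γ.arcHV i).tail, edgeOf p.1 p.2 = none := by
  unfold arcHV
  split_ifs with h
  · simp
  · simp [edgeOf_hv_hv]

/-- `hvUpTo i ≠ []` for `i ≥ 1`. [folklore] -/
theorem hvUpTo_ne_nil {i : ℕ} (hi : 0 < i) : γ.hvUpTo i ≠ [] := by
  obtain ⟨i, rfl⟩ : ∃ j, i = j + 1 := ⟨i - 1, by omega⟩
  exact List.append_ne_nil_of_right_ne_nil _ (arcHV_ne_nil i)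

/-- The last triangle crossed by the first `i + 1` arcs. [folklore] -/
theorem getLast?_hvUpTo_succ (i : ℕ) : (γ.hvUpTo (i + 1)).getLast? = some ((γ.fc i).hv (γ.sOut i)) := by
  show (γ.hvUpTo i ++ γ.arcHV i).getLast? = _
  rw [List.getLast?_append, getLast?_arcHV]; rfl

/-- The first triangle crossed. [folklore] -/
theorem head?_hvUpTo {i : ℕ} (hi : 0 < i) : (γ.hvUpTo i).head? = some ((γ.fc 0).hv (γ.sIn 0)) := by
  induction i with
  | zero => omega
  | succ i ih =>
    show (γ.hvUpTo i ++ γ.arcHV i).head? = _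
    rcases Nat.eq_zero_or_pos i with rfl | hi'
    · show ([] ++ γ.arcHV 0).head? = _
      rw [List.nil_append, head?_arcHV]
    · rw [List.head?_append, ih hi']; rfl

/-- Membership in `hvUpTo`. [folklore] -/
theorem mem_hvUpTo_iff {i : ℕ} {x : HV} : x ∈ γ.hvUpTo i ↔ ∃ k < i, x ∈ γ.arcHV k := by
  induction i with
  | zero => simp [hvUpTo]
  | succ i ih =>
    show x ∈ γ.hvUpTo i ++ γ.arcHV i ↔ _
    rw [List.mem_append, ih]
    constructor
    · rintro (⟨k, hk, hx⟩ | hx)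
      · exact ⟨k, by omega, hx⟩
      · exact ⟨i, by omega, hx⟩
    · rintro ⟨k, hk, hx⟩
      rcases Nat.lt_succ_iff_lt_or_eq.1 hk with hk | rfl
      · exact Or.inl ⟨k, hk, hx⟩
      · exact Or.inr hx

/-- **The triangle list is a honeycomb path**: consecutive arcs meet across a common side of two
different rhombi. [cite: GlazmanManolescu2019, §1] -/
theorem isChain_hvUpTo {i : ℕ} (hi : i ≤ γ.arcs.length) : (γ.hvUpTo i).IsChain hvGraph.Adj := by
  induction i with
  | zero => exact List.IsChain.nil
  | succ i ih =>
    show (γ.hvUpTo i ++ γ.arcHV i).IsChain hvGraph.Adj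
    refine List.IsChain.append (ih (by omega)) (isChain_arcHV i) fun x hx y hy => ?_
    rcases Nat.eq_zero_or_pos i with rfl | hi'
    · simp [hvUpTo] at hx
    obtain ⟨j, rfl⟩ : ∃ j, i = j + 1 := ⟨i - 1, by omega⟩
    rw [getLast?_hvUpTo_succ, Option.mem_def, Option.some_inj] at hx
    rw [head?_arcHV, Option.mem_def, Option.some_inj] at hy
    subst hx; subst hy
    have h1 := (side_sIn (γ := γ) (i := j) (by omega)).2.1
    have h2 := (side_sIn (γ := γ) (i := j + 1) (by omega)).1
    exact hv_adj_of_side_eq (h1.trans h2.symm) (fc_succ_ne (by omega))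

/-- The length of the triangle list is the total cost. [folklore] -/
theorem length_hvUpTo (i : ℕ) : (γ.hvUpTo i).length = ∑ k ∈ Finset.range i, γ.cst k := by
  induction i with
  | zero => rfl
  | succ i ih =>
    show (γ.hvUpTo i ++ γ.arcHV i).length = _
    rw [List.length_append, ih, length_arcHV, Finset.sum_range_succ]

/-- The face and the kind of the `m`-th arc, through its entry and exit sides. [folklore] -/
theorem arcKindOf_getElem {m : ℕ} (hm : m < γ.arcs.length) :
    arcFace γ.arcs[m] = some (γ.fc m) ∧ arcKindOf γ.arcs[m] = some (arcKind (γ.sIn m) (γ.sOut m)) := by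
  have hfa := (arcFace_arcAt hm).1
  rw [arcAt, List.getD_eq_getElem' hm] at hfa
  have hs := side_sIn hm
  obtain ⟨s, t, -, hs1, ht1, hk1⟩ := exists_sides_of_arcFace hfa
  rw [γ.getElem_arcs hm] at hs1 ht1
  have e1 : s = γ.sIn m := Face.side_injective _ (hs1.trans hs.1.symm)
  have e2 : t = γ.sOut m := Face.side_injective _ (ht1.trans hs.2.1.symm)
  exact ⟨hfa, by rw [hk1, e1, e2]⟩

/-- **Two arcs in one rhombus and a nonzero weight force corner arcs**: if two distinct arcs of the
walk lie in the same rhombus, either both cut off `θ`-corners or the rhombus carries two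
`u₂`-arcs and the walk weighs `w₂ = 0` at `π/3` (two straight arcs would cross).
[cite: GlazmanManolescu2019, §1 ("w₂ = 0")] -/
theorem tri_eq_of_weight_ne_zero (hw : γ.weight (fun _ => π / 3) ≠ 0) {k k' : ℕ}
    (hk : k < γ.arcs.length) (hk' : k' < γ.arcs.length) (hkk' : k ≠ k') (hf : γ.fc k' = γ.fc k) :
    (γ.sIn k).tri = (γ.sOut k).tri := by
  by_contra htri
  apply hw
  obtain ⟨ho, d1, d2, d3, d4⟩ := not_straight_of_two_arcs hk hk' hkk' hf
  obtain ⟨ho', -, -, -, -⟩ := not_straight_of_two_arcs hk' hk hkk'.symm hf.symm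
  have hst := (side_sIn hk).2.2
  have hst' := (side_sIn hk').2.2
  obtain ⟨c1, c2⟩ := Side.coCorner_pair hst hst' d1 d2 d3 d4 htri ho ho'
  -- the two arcs contribute two `coCorner` kinds to `kindsIn (fc k)`
  set f := γ.fc k with hfdef
  have hkind : ∀ {m : ℕ} (hm : m < γ.arcs.length), γ.fc m = f → arcKind (γ.sIn m) (γ.sOut m) = .coCorner →
      (if arcFace γ.arcs[m] = some f then arcKindOf γ.arcs[m] else none) = some ArcKind.coCorner := by
    intro m hm hfm hc
    obtain ⟨h1, h2⟩ := arcKindOf_getElem hm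
    rw [hfm] at h1
    rw [if_pos h1, h2, hc]
  have hcount : 2 ≤ (γ.kindsIn f).count .coCorner := by
    have key : ∀ {m m' : ℕ} (hm : m < γ.arcs.length) (hm' : m' < γ.arcs.length), m < m' →
        γ.fc m = f → γ.fc m' = f → arcKind (γ.sIn m) (γ.sOut m) = .coCorner →
        arcKind (γ.sIn m') (γ.sOut m') = .coCorner → 2 ≤ (γ.kindsIn f).count .coCorner := by
      intro m m' hm hm' hmm' hfm hfm' hc hc'
      have hsub : [γ.arcs[m], γ.arcs[m']].Sublist γ.arcs := by
        have h1 : [γ.arcs[m]].Sublist (γ.arcs.take m') := by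
          rw [List.singleton_sublist]
          exact List.mem_iff_getElem.2 ⟨m, by rw [List.length_take]; omega, List.getElem_take⟩
        have h2 : [γ.arcs[m']].Sublist (γ.arcs.drop m') := by
          rw [List.singleton_sublist]
          exact List.mem_iff_getElem.2 ⟨0, by rw [List.length_drop]; omega, by rw [List.getElem_drop]; simp⟩
        have := h1.append h2
        rwa [List.take_append_drop] at this
      set F : MidEdge × MidEdge → Option ArcKind := fun p => if arcFace p = some f then arcKindOf p else none
        with hF
      have := (hsub.filterMap F).count_le ArcKind.coCorner
      have e1 : F γ.arcs[m] = some .coCorner := hkind hm hfm hc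
      have e2 : F γ.arcs[m'] = some .coCorner := hkind hm' hfm' hc'
      rw [List.filterMap_cons_some e1, List.filterMap_cons_some e2, List.filterMap_nil] at this
      rw [kindsIn]
      simpa using this
    rcases lt_or_gt_of_ne hkk' with h | h
    · exact key hk hk' h rfl hf c1 c2
    · exact key hk' hk h hf rfl c2 c1
  have hfmem : f ∈ γ.facesVisited := by
    have hfa := (arcFace_arcAt hk).1
    exact γ.mem_facesVisited_of_arcFace (arcAt_mem hk) hfa
  rw [weight]
  exact Finset.prod_eq_zero hfmem (localWeight_pi_div_three_eq_zero hcount)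

/-- **The triangle list of a walk of nonzero weight has no repetition** (each triangle is crossed
at most once: within an arc trivially, two arcs of one rhombus are corner arcs at opposite corners).
[cite: GlazmanManolescu2019, §1 ("becomes [the self-avoiding walk] on the hexagonal lattice")] -/
theorem nodup_hvUpTo (hw : γ.weight (fun _ => π / 3) ≠ 0) {i : ℕ} (hi : i ≤ γ.arcs.length) :
    (γ.hvUpTo i).Nodup := by
  induction i with
  | zero => exact List.nodup_nil
  | succ i ih =>
    show (γ.hvUpTo i ++ γ.arcHV i).Nodup
    refine List.Nodup.append (ih (by omega)) (nodup_arcHV i) fun x hx hx' => ?_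
    rw [mem_hvUpTo_iff] at hx
    obtain ⟨k, hk, hx⟩ := hx
    rw [mem_arcHV_iff] at hx hx'
    have hki : k ≠ i := by omega
    have hkl : k < γ.arcs.length := by omega
    have hil : i < γ.arcs.length := by omega
    -- same rhombus
    have hf : γ.fc i = γ.fc k := by
      rcases hx with rfl | rfl <;> rcases hx' with h | h <;> exact (Face.hv_eq_hv_iff.1 h).1.symm
    have tk := tri_eq_of_weight_ne_zero hw hkl hil hki hf
    have ti := tri_eq_of_weight_ne_zero hw hil hkl hki.symm hf.symm
    obtain ⟨-, d1, d2, d3, d4⟩ := not_straight_of_two_arcs hkl hil hki hf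
    have hne := Side.tri_four (side_sIn hkl).2.2 (side_sIn hil).2.2 d1 d2 d3 d4 tk ti
    rcases hx with rfl | rfl <;> rcases hx' with h | h <;> have := (Face.hv_eq_hv_iff.1 h).2 <;>
      simp_all

/-- The triangles crossed lie in the rhombi visited. [folklore] -/
theorem exists_fc_of_mem_hvUpTo {i : ℕ} {x : HV} (hx : x ∈ γ.hvUpTo i) :
    ∃ k < i, ∃ s : Side, x = (γ.fc k).hv s := by
  rw [mem_hvUpTo_iff] at hx
  obtain ⟨k, hk, hx⟩ := hx
  rw [mem_arcHV_iff] at hx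
  rcases hx with rfl | rfl
  · exact ⟨k, hk, _, rfl⟩
  · exact ⟨k, hk, _, rfl⟩

/-! ### The weight at `π/3` is `x_c` to the number of triangles -/

/-- Regrouping a list-indexed sum by the values of a partial labelling: the sum over the labels
`f` of the contributions of the elements labelled `f` is the sum of the contributions of all
labelled elements. [folklore] -/
theorem sum_faces_eq {α : Type*} (L : List α) (face : α → Option Face) (val : α → Option ℕ) :
    ∑ f ∈ (L.filterMap face).toFinset,
        (L.filterMap fun p => if face p = some f then val p else none).sum =
      (L.filterMap fun p => (face p).bind fun _ => val p).sum := by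
  induction L with
  | nil => simp
  | cons p L ih =>
    cases hp : face p with
    | none =>
      rw [List.filterMap_cons_none hp]
      have e1 : ∀ f, ((p :: L).filterMap fun q => if face q = some f then val q else none) =
          L.filterMap fun q => if face q = some f then val q else none := fun f => by
        rw [List.filterMap_cons_none]; simp [hp]
      have e2 : ((p :: L).filterMap fun q => (face q).bind fun _ => val q) =
          L.filterMap fun q => (face q).bind fun _ => val q := by
        rw [List.filterMap_cons_none]; simp [hp]
      simp only [e1, e2, ih]
    | some f₀ =>
      rw [List.filterMap_cons_some hp, List.toFinset_cons]
      have e2 : ((p :: L).filterMap fun q => (face q).bind fun _ => val q).sum =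
          (val p).getD 0 + (L.filterMap fun q => (face q).bind fun _ => val q).sum := by
        cases hv : val p with
        | none => rw [List.filterMap_cons_none (by simp [hp, hv])]; simp
        | some v => rw [List.filterMap_cons_some (f := fun q => (face q).bind fun _ => val q)
            (show ((face p).bind fun _ => val p) = some v by simp [hp, hv])]; simp
      have e1 : ∀ f, ((p :: L).filterMap fun q => if face q = some f then val q else none).sum =
          (if f = f₀ then (val p).getD 0 else 0) +
            (L.filterMap fun q => if face q = some f then val q else none).sum := by
        intro f
        by_cases hf : f = f₀
        · subst hf
          rw [if_pos rfl]
          cases hv : val p with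
          | none => rw [List.filterMap_cons_none (by simp [hp, hv])]; simp
          | some v => rw [List.filterMap_cons_some
              (f := fun q => if face q = some f then val q else none)
              (show (if face p = some f then val p else none) = some v by simp [hp, hv])]; simp
        · rw [if_neg hf, List.filterMap_cons_none (by simp [hp, Ne.symm hf]), zero_add]
      rw [Finset.sum_congr rfl fun f _ => e1 f, Finset.sum_add_distrib, Finset.sum_ite_eq',
        if_pos (Finset.mem_insert_self _ _), e2, ← ih, add_right_inj]
      by_cases hmem : f₀ ∈ (L.filterMap face).toFinset
      · rw [Finset.insert_eq_of_mem hmem]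
      · rw [Finset.sum_insert hmem, add_eq_right, List.filterMap_eq_nil_iff.2, List.sum_nil]
        intro q hq
        rw [if_neg]
        intro hq'
        exact hmem (List.mem_toFinset.2 (List.mem_filterMap.2 ⟨q, hq, hq'⟩))

/-- A list whose entries are labelled by an explicit function of the index. [folklore] -/
theorem filterMap_eq_map_range {α : Type*} (l : List α) (g : α → Option ℕ) (c : ℕ → ℕ)
    (h : ∀ (k : ℕ) (hk : k < l.length), g l[k] = some (c k)) :
    l.filterMap g = (List.range l.length).map c := by
  induction l generalizing c with
  | nil => rfl
  | cons x l ih =>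
    have hx : g x = some (c 0) := h 0 (by simp)
    rw [List.filterMap_cons_some hx, List.length_cons, List.range_succ_eq_map, List.map_cons,
      List.map_map]
    congr 1
    exact ih (c ∘ Nat.succ) fun k hk => h (k + 1) (by simpa using hk)

/-- **The total cost is the number of triangles crossed.** [cite: GlazmanManolescu2019, §1] -/
theorem sum_cost_eq_length :
    (γ.arcs.filterMap fun p => (arcFace p).bind fun _ => (arcKindOf p).map ArcKind.cost).sum =
      γ.hvInner.length := by
  rw [hvInner, length_hvUpTo, filterMap_eq_map_range _ _ γ.cst, ← List.sum_toFinset _ List.nodup_range,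
    List.toFinset_range]
  intro k hk
  obtain ⟨h1, h2⟩ := arcKindOf_getElem hk
  rw [h1, Option.bind_some, h2, Option.map_some, cost_arcKind (side_sIn hk).2.2]
  rfl

/-- **The Yang–Baxter weight at `Θ ≡ π/3` is `x_c^{|γ|}`** with `|γ|` the number of triangles
(honeycomb vertices) crossed — or `0` (walks through a `w₂`-rhombus): "with weight
`1/(√(2−√2))^{|γ|}` [sic; `x_c = 1/√(2+√2)`] for any SAW `γ`". [cite: GlazmanManolescu2019, §1 (p. 3)] -/
theorem weight_hex_eq (γ : YBWalk D a z) :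
    γ.weight (fun _ => π / 3) = hexCriticalFugacity ^ γ.hvInner.length ∨ γ.weight (fun _ => π / 3) = 0 := by
  by_cases h0 : ∃ f ∈ γ.facesVisited, localWeight (π / 3) (γ.kindsIn f) = 0
  · right
    obtain ⟨f, hf, h0⟩ := h0
    rw [weight]
    exact Finset.prod_eq_zero hf h0
  left
  push Not at h0
  have hfac : ∀ f ∈ γ.facesVisited, localWeight (π / 3) (γ.kindsIn f) =
      hexCriticalFugacity ^ ((γ.kindsIn f).map ArcKind.cost).sum := fun f hf =>
    (localWeight_pi_div_three _).resolve_right (h0 f hf)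
  rw [weight, Finset.prod_congr rfl hfac, Finset.prod_pow_eq_pow_sum, ← sum_cost_eq_length]
  congr 1
  have hk : ∀ f, ((γ.kindsIn f).map ArcKind.cost).sum =
      (γ.arcs.filterMap fun p => if arcFace p = some f then (arcKindOf p).map ArcKind.cost else none).sum := by
    intro f
    have e : (fun p => (if arcFace p = some f then arcKindOf p else none).map ArcKind.cost) =
        fun p => if arcFace p = some f then (arcKindOf p).map ArcKind.cost else none := by
      funext p; split_ifs <;> rfl
    rw [kindsIn, List.map_filterMap, e]
  simp only [hk]
  exact sum_faces_eq γ.arcs arcFace (fun p => (arcKindOf p).map ArcKind.cost)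

/-! ### Reading the crossed sides off the triangle list -/

/-- The rhombus sides crossed along a list of triangles. [folklore] -/
def pairEdges : List HV → List MidEdge
  | v :: w :: l => (edgeOf v w).toList ++ pairEdges (w :: l)
  | _ => []

/-- A single triangle crosses no side. [folklore] -/
@[simp] theorem pairEdges_singleton (x : HV) : pairEdges [x] = [] := rfl

/-- `pairEdges` of a concatenation. [folklore] -/
theorem pairEdges_append_cons (l : List HV) (hl : l ≠ []) (w : HV) (m : List HV) :
    pairEdges (l ++ w :: m) = pairEdges l ++ (edgeOf (l.getLast hl) w).toList ++ pairEdges (w :: m) := by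
  induction l with
  | nil => exact absurd rfl hl
  | cons x l ih =>
    rcases l with _ | ⟨y, l⟩
    · simp [pairEdges]
    · rw [List.cons_append, List.cons_append, pairEdges, List.getLast_cons (List.cons_ne_nil _ _),
        ← List.cons_append, ih (List.cons_ne_nil _ _), pairEdges]
      simp only [List.append_assoc]

/-- Inside an arc no side is crossed. [folklore] -/
theorem pairEdges_arcHV (i : ℕ) : pairEdges (γ.arcHV i) = [] := by
  unfold arcHV
  split_ifs
  · rfl
  · simp [pairEdges, edgeOf_hv_hv]

/-- **The crossed sides are read off the triangles**: along `v₀ :: hvUpTo i`, where `v₀` is the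
triangle before `a`, the sides crossed are the first `i` mid-edges of the walk.
[cite: GlazmanManolescu2019, §1] -/
theorem pairEdges_cons_hvUpTo (v₀ : HV) (h0 : 0 < γ.arcs.length → edgeOf v₀ ((γ.fc 0).hv (γ.sIn 0)) = some a)
    {i : ℕ} (hi : i ≤ γ.arcs.length) : pairEdges (v₀ :: γ.hvUpTo i) = γ.mids.take i := by
  induction i with
  | zero => simp [hvUpTo]
  | succ i ih =>
    show pairEdges (v₀ :: (γ.hvUpTo i ++ γ.arcHV i)) = _
    obtain ⟨w, m, hwm⟩ : ∃ w m, γ.arcHV i = w :: m := List.exists_cons_of_ne_nil (arcHV_ne_nil i)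
    have hw : w = (γ.fc i).hv (γ.sIn i) := by
      have := head?_arcHV (γ := γ) i; rw [hwm] at this; simpa using this
    rw [hwm, ← List.cons_append, pairEdges_append_cons _ (List.cons_ne_nil _ _), ih (by omega), ← hwm,
      pairEdges_arcHV, List.append_nil, List.take_succ_eq_append_getElem (by have := γ.length_arcs; omega)]
    congr 1
    rcases Nat.eq_zero_or_pos i with rfl | hi'
    · rw [hw]; simp only [hvUpTo, List.getLast_singleton, h0 (by omega), Option.toList_some, γ.getElem_zero]
    · obtain ⟨j, rfl⟩ : ∃ j, i = j + 1 := ⟨i - 1, by omega⟩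
      rw [List.getLast_cons (hvUpTo_ne_nil (by omega)), hw]
      have hl : (γ.hvUpTo (j + 1)).getLast (hvUpTo_ne_nil (by omega)) = (γ.fc j).hv (γ.sOut j) := by
        apply Option.some_injective
        rw [← List.getLast?_eq_some_getLast, getLast?_hvUpTo_succ]
      rw [hl]
      have h1 := (side_sIn (γ := γ) (i := j) (by omega)).2.1
      have h2 := (side_sIn (γ := γ) (i := j + 1) (by omega)).1
      rw [edgeOf_of_side_eq (h1.trans h2.symm) (fc_succ_ne (by omega)), h1]
      rfl

end YBWalk

/-! ### Bridges of `Strip_T(π/3)` as bridges of the honeycomb strip `S_T` -/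

section Bridge

variable {T : ℕ} {j : ℤ}

/-- **The honeycomb walk of a Yang–Baxter bridge**: the vertex `w` below the origin, the triangles
crossed, and the triangle beyond the right-boundary edge `vert T j` — a vertex list in the format
`HV.IsMidWalk` of `HexSAWStrip.lean`. [cite: GlazmanManolescu2019, §1 (Fig. 2)] -/
def hvBridge (γ : YBWalk (strip T) origin (.vert T j)) : List HV :=
  HV.wOut :: (γ.hvInner ++ [(-j, (T : ℤ), false)])

variable (hT : 1 ≤ T) (γ : YBWalk (strip T) origin (.vert T j))
include hT

/-- A bridge has at least one arc. [folklore] -/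
theorem arcs_length_pos_of_bridge : 0 < γ.arcs.length := by
  rw [γ.length_arcs]
  by_contra h
  have h1 : γ.mids.length = 1 := by have := γ.length_pos; omega
  have e0 := γ.getElem_zero
  have e1 := γ.getElem_length_sub_one
  simp only [h1, Nat.sub_self] at e1
  rw [e0] at e1
  simp [origin] at e1
  omega

/-- The first arc of a bridge lies in the rhombus `(0, 0)` and enters through its `W` side.
[cite: GlazmanManolescu2019, §1] -/
theorem fc_zero_of_bridge : γ.fc 0 = (0, 0) ∧ γ.sIn 0 = .W := by
  have h0 := arcs_length_pos_of_bridge hT γ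
  obtain ⟨hs, -, -⟩ := YBWalk.side_sIn h0
  rw [γ.getElem_zero] at hs
  have hD := (YBWalk.arcFace_arcAt h0).2
  rcases hfc : γ.fc 0 with ⟨k, l⟩
  rw [hfc] at hs hD
  obtain ⟨hD1, hD2⟩ := hD
  dsimp only at hD1 hD2
  cases hs0 : γ.sIn 0 <;> rw [hs0] at hs <;>
    simp only [Face.side, origin, MidEdge.vert.injEq, reduceCtorEq, Prod.mk.injEq, and_true,
      and_false] at hs ⊢ <;> omega

/-- The last arc of a bridge lies in the rhombus `(T-1, j)` and leaves through its `E` side.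
[cite: GlazmanManolescu2019, §1] -/
theorem fc_last_of_bridge :
    γ.fc (γ.arcs.length - 1) = ((T : ℤ) - 1, j) ∧ γ.sOut (γ.arcs.length - 1) = .E := by
  have h0 := arcs_length_pos_of_bridge hT γ
  obtain ⟨-, ht, -⟩ := YBWalk.side_sIn (γ := γ) (i := γ.arcs.length - 1) (by omega)
  have hidx : γ.arcs.length - 1 + 1 = γ.mids.length - 1 := by have := γ.length_arcs; omega
  simp only [hidx] at ht
  rw [γ.getElem_length_sub_one] at ht
  have hD := (YBWalk.arcFace_arcAt (γ := γ) (i := γ.arcs.length - 1) (by omega)).2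
  rcases hfc : γ.fc (γ.arcs.length - 1) with ⟨k, l⟩
  rw [hfc] at ht hD
  obtain ⟨hD1, hD2⟩ := hD
  dsimp only at hD1 hD2
  cases hs0 : γ.sOut (γ.arcs.length - 1) <;> rw [hs0] at ht <;>
    simp only [Face.side, MidEdge.vert.injEq, reduceCtorEq, Prod.mk.injEq, and_true,
      and_false] at ht ⊢ <;> omega

/-- The first triangle crossed by a bridge is the origin `O` of `HV`. [cite: GlazmanManolescu2019, §1] -/
theorem hv_zero_of_bridge : (γ.fc 0).hv (γ.sIn 0) = hvOrigin := by
  obtain ⟨h1, h2⟩ := fc_zero_of_bridge hT γ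
  rw [h1, h2]; rfl

/-- The last triangle crossed by a bridge is `(-j, T-1, true)`, on the top level of `S_T`.
[cite: GlazmanManolescu2019, §1] -/
theorem hv_last_of_bridge :
    (γ.fc (γ.arcs.length - 1)).hv (γ.sOut (γ.arcs.length - 1)) = (-j, (T : ℤ) - 1, true) := by
  obtain ⟨h1, h2⟩ := fc_last_of_bridge hT γ
  rw [h1, h2]; rfl

/-- **The honeycomb walk of a Yang–Baxter bridge of nonzero weight is a self-avoiding walk of
`S_{T,L'}` from `a`** (for `L' ≥ T + rowBound`). [cite: GlazmanManolescu2019, §1 (p. 3)] -/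
theorem isMidWalk_hvBridge (hw : γ.weight (fun _ => π / 3) ≠ 0) {L' : ℕ} (hL : T + γ.rowBound ≤ L') :
    HV.IsMidWalk (HV.stripV T L') (hvBridge γ) := by
  have h0 := arcs_length_pos_of_bridge hT γ
  have hne : γ.hvInner ≠ [] := YBWalk.hvUpTo_ne_nil h0
  rw [hvBridge, HV.isMidWalk_cons_append_iff _ hne]
  have hlast : γ.hvInner.getLast hne = (-j, (T : ℤ) - 1, true) := by
    apply Option.some_injective
    rw [← List.getLast?_eq_some_getLast, YBWalk.hvInner, show γ.arcs.length = γ.arcs.length - 1 + 1 by omega,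
      YBWalk.getLast?_hvUpTo_succ, ← hv_last_of_bridge hT γ]
  refine ⟨YBWalk.isChain_hvUpTo le_rfl, ?_, ?_, ?_, YBWalk.nodup_hvUpTo hw le_rfl, ?_⟩
  · rw [YBWalk.hvInner, YBWalk.head?_hvUpTo h0, hv_zero_of_bridge hT γ]
  · rw [hlast]; simp [hvGraph_adj, HV.AdjRel]
  · intro x hx
    obtain ⟨k, hk, s, rfl⟩ := YBWalk.exists_fc_of_mem_hvUpTo hx
    have hfa := YBWalk.arcFace_arcAt (γ := γ) hk
    have hrow := γ.natAbs_lt_rowBound (γ.mem_facesVisited_of_arcFace (YBWalk.arcAt_mem hk) hfa.1)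
    obtain ⟨h1, h2⟩ := hfa.2
    rw [HV.mem_stripV_iff]
    have hb : HV.bit ((γ.fc k).hv s) ≤ 1 ∧ 0 ≤ HV.bit ((γ.fc k).hv s) := by
      cases s <;> simp [Face.hv, Side.tri, HV.bit]
    simp only [Face.hv, HV.lev] at hb ⊢
    omega
  · intro h
    rcases HV.prevOf_mem γ.hvInner with h' | h'
    · rw [h'] at h; simp [HV.wOut] at h
    · rw [← h] at h'
      obtain ⟨k, hk, s, hs⟩ := YBWalk.exists_fc_of_mem_hvUpTo h'
      have := (YBWalk.arcFace_arcAt (γ := γ) hk).2.2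
      have e := congrArg (fun v : HV => v.2.1) hs
      simp [Face.hv] at e
      omega

/-- The final half-edge of the honeycomb walk of a bridge is on `β`. [cite: GlazmanManolescu2019, §1] -/
theorem isBetaDart_hvBridge : HV.IsBetaDart T (HV.finalDart (hvBridge γ)) := by
  have h0 := arcs_length_pos_of_bridge hT γ
  have hne : γ.hvInner ≠ [] := YBWalk.hvUpTo_ne_nil h0
  have hlast : γ.hvInner.getLast hne = (-j, (T : ℤ) - 1, true) := by
    apply Option.some_injective
    rw [← List.getLast?_eq_some_getLast, YBWalk.hvInner, show γ.arcs.length = γ.arcs.length - 1 + 1 by omega,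
      YBWalk.getLast?_hvUpTo_succ, ← hv_last_of_bridge hT γ]
  rw [hvBridge, HV.finalDart_cons_append hne, hlast]
  exact ⟨rfl, rfl, by simp⟩

omit hT in
/-- The length of the honeycomb walk of a bridge is the number of triangles crossed. [folklore] -/
theorem mwLen_hvBridge : HV.mwLen (hvBridge γ) = γ.hvInner.length := by
  rw [hvBridge, HV.mwLen_cons_append]

omit hT in
/-- The last vertex of the honeycomb walk of a bridge. [folklore] -/
theorem getLast_hvBridge :
    (hvBridge γ).getLast (List.cons_ne_nil _ _) = (-j, (T : ℤ), false) := by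
  show (HV.wOut :: (γ.hvInner ++ [(-j, (T : ℤ), false)])).getLast _ = _
  rw [List.getLast_cons (by simp), List.getLast_append_of_ne_nil _ (by simp), List.getLast_singleton]

/-- **The encoding is injective**: the crossed mid-edges are read off the honeycomb walk.
[cite: GlazmanManolescu2019, §1] -/
theorem pairEdges_hvBridge : YBWalk.pairEdges (hvBridge γ) = γ.mids := by
  have h0 := arcs_length_pos_of_bridge hT γ
  have hstart : 0 < γ.arcs.length → edgeOf HV.wOut ((γ.fc 0).hv (γ.sIn 0)) = some origin := fun _ => by
    rw [hv_zero_of_bridge hT γ]; simp [edgeOf, HV.wOut, hvOrigin, origin]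
  rw [hvBridge, ← List.cons_append, YBWalk.pairEdges_append_cons _ (List.cons_ne_nil _ _), YBWalk.hvInner,
    YBWalk.pairEdges_cons_hvUpTo HV.wOut hstart le_rfl, List.getLast_cons (YBWalk.hvUpTo_ne_nil h0)]
  have hl : (γ.hvUpTo γ.arcs.length).getLast (YBWalk.hvUpTo_ne_nil h0) = (-j, (T : ℤ) - 1, true) := by
    apply Option.some_injective
    rw [← List.getLast?_eq_some_getLast, show γ.arcs.length = γ.arcs.length - 1 + 1 by omega,
      YBWalk.getLast?_hvUpTo_succ, ← hv_last_of_bridge hT γ]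
  rw [hl, show edgeOf (-j, (T : ℤ) - 1, true) (-j, (T : ℤ), false) = some (.vert T j) by
    simp [edgeOf]]
  rw [Option.toList_some, YBWalk.pairEdges_singleton, List.append_nil]
  conv_rhs => rw [← List.take_append_drop γ.arcs.length γ.mids]
  congr 1
  rw [γ.length_arcs, List.drop_eq_getElem_cons (by have := γ.length_pos; omega), γ.getElem_length_sub_one,
    List.drop_eq_nil_of_le (by omega)]

end Bridge

/-! ### The bound by Duminil-Copin–Smirnov's bridges and the discharge -/

/-- **Yang–Baxter bridges at `π/3` inject into honeycomb bridges**: for a finite set of bridges of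
`Strip_T(π/3)` (any right-boundary endpoints), the total weight is at most DCS's `B_{T,L'}(x_c)`
for `L'` large. [cite: GlazmanManolescu2019, §1 and §4 ("SAW on H(π/3) is identical to that on the hexagonal lattice")] -/
theorem sum_weight_le_stripB {T : ℕ} (hT : 1 ≤ T)
    (s : Finset (Σ j : ℤ, YBWalk (strip T) origin (.vert T j))) :
    ∃ L₀ : ℕ, ∀ L', L₀ ≤ L' →
      ∑ p ∈ s, p.2.weight (fun _ => π / 3) ≤ HV.stripB T L' hexCriticalFugacity := by
  classical
  refine ⟨T + s.sup fun p => p.2.rowBound, fun L' hL' => ?_⟩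
  set s₁ := s.filter fun p => p.2.weight (fun _ => π / 3) ≠ 0 with hs₁
  have hsum : ∑ p ∈ s, p.2.weight (fun _ => π / 3) = ∑ p ∈ s₁, p.2.weight (fun _ => π / 3) := by
    rw [hs₁, Finset.sum_filter]
    exact Finset.sum_congr rfl fun p _ => by split_ifs with h <;> [rfl; (push Not at h; exact h)]
  rw [hsum, HV.stripB]
  have hinj : Set.InjOn (fun p : (Σ j : ℤ, YBWalk (strip T) origin (.vert T j)) => hvBridge p.2) s₁ := by
    intro p _ q _ h
    obtain ⟨j, γ⟩ := p
    obtain ⟨j', γ'⟩ := q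
    dsimp only at h
    have hj : j = j' := by
      have e1 := getLast_hvBridge γ
      have e2 := getLast_hvBridge γ'
      simp only [h] at e1
      rw [e1] at e2
      simpa using e2
    subst hj
    have hm : γ.mids = γ'.mids := by
      rw [← pairEdges_hvBridge hT γ, ← pairEdges_hvBridge hT γ', h]
    rw [YBWalk.ext hm]
  have key := HV.sum_le_sum_of_injOn_of_nonneg (s := s₁)
    (t := (HV.midWalks (HV.stripV T L')).filter fun P => HV.IsBetaDart T (HV.finalDart P))
    (fun p => hvBridge p.2) hinj ?_ (fun P => hexCriticalFugacity ^ HV.mwLen P)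
    (fun _ _ => pow_nonneg hexCriticalFugacity_pos_lt_one.1.le _)
  · refine le_trans (le_of_eq (Finset.sum_congr rfl fun p hp => ?_)) key
    rw [hs₁, Finset.mem_filter] at hp
    rw [mwLen_hvBridge p.2, (YBWalk.weight_hex_eq p.2).resolve_right hp.2]
  · intro p hp
    rw [hs₁, Finset.mem_filter] at hp
    rw [Finset.mem_filter, HV.mem_midWalks_iff]
    refine ⟨isMidWalk_hvBridge hT p.2 hp.2 (le_trans ?_ hL'), isBetaDart_hvBridge hT p.2⟩
    exact Nat.add_le_add_left
      (Finset.le_sup (f := fun p : (Σ j : ℤ, YBWalk (strip T) origin (.vert T j)) => p.2.rowBound) hp.1) T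

/-- **`B_T(π/3) ≤ ε` eventually**: the Yang–Baxter bridge partition function of `Strip_T(π/3)` is
bounded by the honeycomb bridges, which are eventually small (`HV.stripB_eventually_le`).
[cite: GlazmanManolescu2019, Proposition 1.1] -/
theorem bridgePartitionFunction_hex_le {ε : ℝ} (hε : 0 < ε) :
    ∃ T₀ : ℕ, ∀ T, T₀ ≤ T → bridgePartitionFunction T (fun _ => π / 3) ≤ ENNReal.ofReal ε := by
  obtain ⟨T₀, hT₀⟩ := HV.stripB_eventually_le hε
  refine ⟨max T₀ 1, fun T hT => ?_⟩
  have hT1 : 1 ≤ T := le_trans (le_max_right _ _) hT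
  have hhex : ∀ k : ℤ, (fun _ : ℤ => π / 3) k ∈ Set.Icc (π / 3) (2 * π / 3) := fun _ => pi_div_three_mem_Icc
  unfold bridgePartitionFunction twoPoint
  rw [← ENNReal.tsum_sigma' (β := fun jj : ℤ => YBWalk (strip T) origin (.vert T jj))
    (fun p => ENNReal.ofReal (p.2.weight fun _ => π / 3)), ENNReal.tsum_eq_iSup_sum]
  refine iSup_le fun s => ?_
  obtain ⟨L₀, hL₀⟩ := sum_weight_le_stripB hT1 s
  rw [← ENNReal.ofReal_sum_of_nonneg fun p _ => p.2.weight_nonneg hhex]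
  exact ENNReal.ofReal_le_ofReal ((hL₀ L₀ le_rfl).trans (hT₀ T (le_trans (le_max_left _ _) hT) L₀))

/-- **Glazman–Manolescu, Proposition 1.1 (limit part) / [BBDDG, Thm 10]**, discharge of the named
fact `GlazmanManolescu2019_prop11_limit`: "the partition function of self-avoiding bridges on the
hexagonal lattice vanishes at infinity: `B_T(π/3) → 0` as `T → ∞`", for the bridge partition
function `bridgePartitionFunction T (fun _ => π/3)` of the Yang–Baxter walk with all angles `π/3`.
Proof: the walks of `H(π/3)` are the self-avoiding walks of the hexagonal lattice with weight
`x_c^{|γ|}` (`sum_weight_le_stripB`), and on the hexagonal lattice `B_T → 0` by the parafermionic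
identity in equilateral triangles and the rotation by `π/3` (`HexSAWTriangle.lean`,
`HexSAWBridgeDecay.lean`, the printed §4.1). [cite: GlazmanManolescu2019, Proposition 1.1] -/
theorem GlazmanManolescu2019_prop11_limit_holds : GlazmanManolescu2019_prop11_limit := by
  rw [GlazmanManolescu2019_prop11_limit, ENNReal.tendsto_atTop_zero]
  intro ε hε
  by_cases htop : ε = ⊤
  · exact ⟨0, fun T _ => htop ▸ le_top⟩
  have hε' : 0 < ε.toReal := ENNReal.toReal_pos hε.ne' htop
  obtain ⟨T₀, hT₀⟩ := bridgePartitionFunction_hex_le hε'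
  refine ⟨T₀, fun T hT => ?_⟩
  rw [← ENNReal.ofReal_toReal htop]
  exact hT₀ T hT

end Literature.Probability.RandomPlanarGeometry.SAW.YangBaxter
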